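import Summits.ResolutionOfSingularities.ResolutionOfSingularities.Theorems.FrobeniusLadderFRationalResolutionFixedPointTwoStepModel
import Summits.ResolutionOfSingularities.ResolutionOfSingularities.Theorems.FrobeniusLadderFRationalResolutionModelIsolatedOffVertex
import HarnessLib

/-!
# Crux `FrobeniusLadder.FRationalResolution` (stmt-ResolutionOfSingularities-15317), line `redirect`,
# stub `stub_diagonalizableQuotientResolution` — THE NAIVE TWO-STEP RECIPE AT FIXED POINTS OF QUOTIENT CHARTS, FINAL FORM:
# fixed-point data + a charted model + the two chart facts ⇒ `hloc` / `HasResolution` (no `e`, no `hoff`)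

`…FixedPointTwoStepModel` (p843151) produced the model isomorphism `e : (T_𝔳)^ ≅ (𝒪_{Spec S₀,𝔮})^` at a `D(A)`-fixed prime;
`…ModelIsolatedOffVertex` (p843182) showed that the off-vertex regularity `hoff` of the model follows from `e` and the
isolatedness of the singular point. Combining the two, the naive two-step recipe at a fixed point of a quotient chart needs
exactly: the fixed-point data of the stub's frame, a model `T` of finite type over `κ(𝔮)` charted by the weight kernel `P` at a
`κ(𝔮)`-rational maximal ideal `𝔳` of height `n`, generators `yⱼ` of `𝔳^{b+1}` and the two chart facts on `T[𝔳^{b+1}/yⱼ]`.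

* ★★★ `hloc_of_fixedPoint_two_step_chart'` — `hloc` at `φ 𝔮`;
* ★★★ `hasResolution_of_isolated_fixedPoints_of_two_step_chart'` — every singular point of this kind ⇒ `Scheme.HasResolution X`.

Honest label: assembly toward ONE leaf stub (no stub, crux or summit closed). No definitions, no named facts, no sorry.
[cite: Kato1994, Thm. (3.2)] [cite: Kollar2007, §2.2] [cite: Matsumura1987, Thm. 8.11; Thm. 23.7; §32 p. 256]
-/

noncomputable section

-- single-problem summit: the doubled namespace component is forced
set_option linter.dupNamespace false

open CategoryTheory AlgebraicGeometry TopologicalSpace IsLocalRing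
open Literature.AlgebraicGeometry.Resolution

namespace Summit.ResolutionOfSingularities.ResolutionOfSingularities.Theorems.FRationalResolution.FixedPointTwoStepModel

variable {k' : Type} [Field k'] {A : Type} [DecidableEq A] [AddCommGroup A] {S : Type}
  [CommRing S] [Algebra k' S] (𝒮 : A → Submodule k' S) [GradedAlgebra 𝒮]

/-- ★★★ **THE NAIVE TWO-STEP RECIPE AT A FIXED POINT — no `e`, no `hoff`.** As `hloc_of_fixedPoint_two_step_chart` without the
off-vertex hypothesis on the model (`…ModelIsolatedOffVertex.hoff_of_etale_nhd` along the produced model isomorphism).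
[cite: Kato1994, Thm. (3.2)] [cite: Kollar2007, §2.2] [cite: Matsumura1987, Thm. 8.11; Thm. 23.7; §32 p. 256] -/
theorem hloc_of_fixedPoint_two_step_chart' (k : Type) [Field k] (X : Scheme.{0}) [IsIntegral X]
    (f : X ⟶ Spec (.of k)) [LocallyOfFiniteType f] (hfin : (Scheme.regularLocus X)ᶜ.Finite)
    [Algebra.FiniteType k' S] (hA : AddMonoid.IsTorsion A)
    (φ : Spec (.of (𝒮 0)) ⟶ X) [Etale φ] (𝔔 : Ideal S) [𝔔.IsPrime]
    (hfix : ∀ a : A, a ≠ 0 → ∀ s ∈ 𝒮 a, s ∈ 𝔔)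
    (hx : φ ⟨𝔔.comap (algebraMap (𝒮 0) S), inferInstance⟩ ∉ Scheme.regularLocus X)
    {n : ℕ} (x : Fin n → S) (a : Fin n → A) (hxa : ∀ i, x i ∈ 𝔔 ∧ x i ∈ 𝒮 (a i))
    (hspan : Ideal.span (algebraMap S (Localization.AtPrime 𝔔) '' Set.range x) =
      maximalIdeal (Localization.AtPrime 𝔔))
    (hn : (n : WithBot ℕ∞) = ringKrullDim (Localization.AtPrime 𝔔))
    (P : AddSubmonoid (Fin n →₀ ℕ)) (hP : ∀ m, m ∈ P ↔ Finsupp.weight a m = 0)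
    (T : Type) [CommRing T] [Algebra (ResidueField (Localization.AtPrime (𝔔.comap (algebraMap (𝒮 0) S)))) T]
    [Algebra.FiniteType (ResidueField (Localization.AtPrime (𝔔.comap (algebraMap (𝒮 0) S)))) T]
    (𝔳 : Ideal T) [𝔳.IsMaximal]
    (hres : ∀ z : Localization.AtPrime 𝔳, ∃ c : ResidueField (Localization.AtPrime (𝔔.comap (algebraMap (𝒮 0) S))),
      z - algebraMap _ (Localization.AtPrime 𝔳) c ∈ maximalIdeal (Localization.AtPrime 𝔳))
    (χ : (Fin n →₀ ℕ) → T) (hχ0 : χ 0 = 1) (hχadd : ∀ p ∈ P, ∀ q ∈ P, χ (p + q) = χ p * χ q)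
    (hχm : ∀ p ∈ P, p ≠ 0 → χ p ∈ 𝔳) (hgen : 𝔳 ≤ Ideal.span (χ '' {p | p ∈ P ∧ p ≠ 0}))
    (hdim : ringKrullDim (Localization.AtPrime 𝔳) = n)
    (b : ℕ) {m : ℕ} (y : Fin m → T) (hyv : 𝔳 ^ (b + 1) = Ideal.span (Set.range y))
    (hfinm : ∀ j : Fin m, {𝔫 : PrimeSpectrum (blowupAlgebra (𝔳 ^ (b + 1)) (y j)) |
      𝔳.map (algebraMap T (blowupAlgebra (𝔳 ^ (b + 1)) (y j))) ≤ 𝔫.asIdeal ∧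
        ¬ IsRegularLocalRing (Localization.AtPrime 𝔫.asIdeal)}.Finite)
    (hmodel : ∀ (j : Fin m) (𝔫 : PrimeSpectrum (blowupAlgebra (𝔳 ^ (b + 1)) (y j))),
      𝔳.map (algebraMap T (blowupAlgebra (𝔳 ^ (b + 1)) (y j))) ≤ 𝔫.asIdeal →
      ¬ IsRegularLocalRing (Localization.AtPrime 𝔫.asIdeal) →
      Scheme.IsRegular (affineBlowup (R := Localization.AtPrime 𝔫.asIdeal)
        (maximalIdeal (Localization.AtPrime 𝔫.asIdeal)))) :
    ∃ (W : X.Opens), φ ⟨𝔔.comap (algebraMap (𝒮 0) S), inferInstance⟩ ∈ W ∧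
      (∀ t : X, t ∉ Scheme.regularLocus X → t ∈ W → t = φ ⟨𝔔.comap (algebraMap (𝒮 0) S), inferInstance⟩) ∧
      ∃ (Z : Scheme.{0}) (ρ : Z ⟶ W), IsProper ρ ∧ Scheme.IsRegular Z ∧
        IsIso (ρ ∣_ (W.ι ⁻¹ᵁ ⟨Scheme.regularLocus X, isOpen_regularLocus_of_locallyOfFiniteType_field f⟩)) ∧
        Dense ((ρ ⁻¹ᵁ (W.ι ⁻¹ᵁ ⟨Scheme.regularLocus X,
          isOpen_regularLocus_of_locallyOfFiniteType_field f⟩) : Z.Opens) : Set Z) := by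
  haveI : IsNoetherianRing T :=
    Algebra.FiniteType.isNoetherianRing (ResidueField (Localization.AtPrime (𝔔.comap (algebraMap (𝒮 0) S)))) T
  obtain ⟨e⟩ := exists_ringEquiv_adicCompletion_stalk_of_chart 𝒮 hA 𝔔 hfix x a hxa hspan hn P hP 𝔳 hres χ hχ0 hχadd
    hχm hgen hdim
  exact ModelIsolatedOffVertex.hloc_of_model_charts_etale_nhd' k X f hfin φ _ hx b
    (ResidueField (Localization.AtPrime (𝔔.comap (algebraMap (𝒮 0) S)))) T 𝔳 e y hyv hfinm hmodel

/-- ★★★ **RESOLUTION OF VARIETIES WHOSE SINGULAR POINTS ARE ISOLATED FIXED POINTS OF QUOTIENT CHARTS WITH A CHARTED MODEL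
RESOLVED BY THE NAIVE TWO-STEP RECIPE — final form (no `e`, no `hoff`).**
[cite: Kato1994, Thm. (3.2)] [cite: Kollar2007, §2.2] [cite: Matsumura1987, Thm. 8.11; Thm. 23.7; §32 p. 256] -/
theorem hasResolution_of_isolated_fixedPoints_of_two_step_chart' (k : Type) [Field k] (X : Scheme.{0}) [IsIntegral X]
    (f : X ⟶ Spec (.of k)) [LocallyOfFiniteType f] (hfin : (Scheme.regularLocus X)ᶜ.Finite)
    (hchart : ∀ t : X, t ∉ Scheme.regularLocus X →
      ∃ (k' : Type) (_ : Field k') (A : Type) (_ : DecidableEq A) (_ : AddCommGroup A) (_ : AddMonoid.IsTorsion A)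
        (S : Type) (_ : CommRing S) (_ : Algebra k' S) (𝒮 : A → Submodule k' S) (_ : GradedAlgebra 𝒮)
        (_ : Algebra.FiniteType k' S) (φ : Spec (.of (𝒮 0)) ⟶ X) (_ : Etale φ)
        (𝔔 : Ideal S) (_ : 𝔔.IsPrime) (_ : ∀ a : A, a ≠ 0 → ∀ s ∈ 𝒮 a, s ∈ 𝔔)
        (n : ℕ) (x : Fin n → S) (a : Fin n → A) (P : AddSubmonoid (Fin n →₀ ℕ))
        (_ : ∀ i, x i ∈ 𝔔 ∧ x i ∈ 𝒮 (a i))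
        (_ : Ideal.span (algebraMap S (Localization.AtPrime 𝔔) '' Set.range x) = maximalIdeal (Localization.AtPrime 𝔔))
        (_ : (n : WithBot ℕ∞) = ringKrullDim (Localization.AtPrime 𝔔))
        (_ : ∀ m, m ∈ P ↔ Finsupp.weight a m = 0)
        (T : Type) (_ : CommRing T) (_ : Algebra (ResidueField (Localization.AtPrime (𝔔.comap (algebraMap (𝒮 0) S)))) T)
        (_ : Algebra.FiniteType (ResidueField (Localization.AtPrime (𝔔.comap (algebraMap (𝒮 0) S)))) T)
        (𝔳 : Ideal T) (_ : 𝔳.IsMaximal)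
        (_ : ∀ z : Localization.AtPrime 𝔳, ∃ c : ResidueField (Localization.AtPrime (𝔔.comap (algebraMap (𝒮 0) S))),
          z - algebraMap _ (Localization.AtPrime 𝔳) c ∈ maximalIdeal (Localization.AtPrime 𝔳))
        (χ : (Fin n →₀ ℕ) → T) (_ : χ 0 = 1) (_ : ∀ p ∈ P, ∀ q ∈ P, χ (p + q) = χ p * χ q)
        (_ : ∀ p ∈ P, p ≠ 0 → χ p ∈ 𝔳) (_ : 𝔳 ≤ Ideal.span (χ '' {p | p ∈ P ∧ p ≠ 0}))
        (_ : ringKrullDim (Localization.AtPrime 𝔳) = n)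
        (b m : ℕ) (y : Fin m → T) (_ : 𝔳 ^ (b + 1) = Ideal.span (Set.range y))
        (_ : ∀ j : Fin m, {𝔫 : PrimeSpectrum (blowupAlgebra (𝔳 ^ (b + 1)) (y j)) |
          𝔳.map (algebraMap T (blowupAlgebra (𝔳 ^ (b + 1)) (y j))) ≤ 𝔫.asIdeal ∧
            ¬ IsRegularLocalRing (Localization.AtPrime 𝔫.asIdeal)}.Finite),
        φ ⟨𝔔.comap (algebraMap (𝒮 0) S), inferInstance⟩ = t ∧
        ∀ (j : Fin m) (𝔫 : PrimeSpectrum (blowupAlgebra (𝔳 ^ (b + 1)) (y j))),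
          𝔳.map (algebraMap T (blowupAlgebra (𝔳 ^ (b + 1)) (y j))) ≤ 𝔫.asIdeal →
          ¬ IsRegularLocalRing (Localization.AtPrime 𝔫.asIdeal) →
          Scheme.IsRegular (affineBlowup (R := Localization.AtPrime 𝔫.asIdeal)
            (maximalIdeal (Localization.AtPrime 𝔫.asIdeal)))) :
    Scheme.HasResolution X := by
  refine IsolatedGlue.hasResolution_of_finite_singularLocus_of_local k X f hfin fun t ht => ?_
  obtain ⟨k', _, A, _, _, hA, S, _, _, 𝒮, _, _, φ, _, 𝔔, _, hfix, n, x, a, P, hxa, hspan, hn, hP, T, _, _, _, 𝔳, _,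
    hres, χ, hχ0, hχadd, hχm, hgen, hdim, b, m, y, hyv, hfinm, hφt, hmodel⟩ := hchart t ht
  subst hφt
  exact hloc_of_fixedPoint_two_step_chart' 𝒮 k X f hfin hA φ 𝔔 hfix ht x a hxa hspan hn P hP T 𝔳 hres χ hχ0 hχadd hχm
    hgen hdim b y hyv hfinm hmodel

end Summit.ResolutionOfSingularities.ResolutionOfSingularities.Theorems.FRationalResolution.FixedPointTwoStepModel

end
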